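import Mathlib.Geometry.Manifold.IsManifold.InteriorBoundary
import Mathlib.Geometry.Manifold.Instances.Real
import Literature.Topology.Euclidean.InvarianceOfDomain
import HarnessLib

/-!
# Invariance of the boundary under equidimensional topological embeddings

Topic `Literature/Topology/FourManifolds`.  A consequence of Brouwer's invariance of domain
(`Literature.Topology.Euclidean.Brouwer.isOpen_image_of_injOn`, `InvarianceOfDomain.lean`):

**Theorem** (`isInteriorPoint_of_range_mem_nhds`).  *Let `W` be a topological `(n+1)`-manifold
with boundary (a charted space on the half-space `EuclideanHalfSpace (n+1)`), `X` a topological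
`(n+1)`-manifold without boundary (charted on `ℝⁿ⁺¹`) and `e : W → X` a topological embedding.
If `e(W)` is a neighbourhood of `e w` in `X`, then `w` is an interior point of `W`.*
Equivalently, boundary points of `W` go to points of `X` at which `e(W)` is not a neighbourhood
(`not_mem_nhds_of_isBoundaryPoint`): "invariance of the boundary" (Hatcher, *Algebraic Topology*
(2002), Thm. 2B.3 and the paragraph after it; Lee, *Introduction to Topological Manifolds*
(2011), Thm. 2B / Cor. on invariance of the boundary).  Read in the two charts, `e` becomes a
continuous injection of an open subset of `ℝⁿ⁺¹` into `ℝⁿ⁺¹` with image in the closed half-space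
`{x₀ ≥ 0}`, open by invariance of domain, hence inside `{x₀ > 0}`.  Used for the sectors of a
Gay–Kirby trisection (`Trisections.lean`, clause (ii): `S i ∩ S j ⊆ e(∂W)`, and conversely every
point of `e(∂W)` lies in another sector).  No definitions, no named facts.

## References

* A. Hatcher, *Algebraic Topology*, CUP (2002), Thm. 2B.3 (invariance of domain) and the remark
  following it (boundary points of manifolds with boundary are well defined). [HatcherAT2002]
* L. E. J. Brouwer, *Beweis der Invarianz des `n`-dimensionalen Gebiets*, Math. Ann. 71 (1911).
  [Brouwer1911b]
-/

noncomputable section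

open Set Function Filter Topology

namespace Literature.Topology.FourManifolds

open scoped Manifold

variable {n : ℕ} {W X : Type*} [TopologicalSpace W] [ChartedSpace (EuclideanHalfSpace (n + 1)) W]
  [TopologicalSpace X] [ChartedSpace (EuclideanSpace ℝ (Fin (n + 1))) X]

/-- **Invariance of the boundary.**  For a topological embedding `e : W → X` of an
`(n+1)`-manifold with boundary into an `(n+1)`-manifold without boundary: if `range e` is a
neighbourhood of `e w`, then `w` is an interior point of `W` (Brouwer's invariance of domain read
in charts: the image of a neighbourhood of `w` in the half-space chart is open in `ℝⁿ⁺¹` and lies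
in `{x₀ ≥ 0}`, so the chart value of `w` has `x₀ > 0`). [cite: HatcherAT2002, Thm. 2B.3 and the remark following it] -/
theorem isInteriorPoint_of_range_mem_nhds {e : W → X} (he : IsEmbedding e) {w : W}
    (h : range e ∈ 𝓝 (e w)) : (𝓡∂ (n + 1)).IsInteriorPoint w := by
  classical
  haveI : Nonempty W := ⟨w⟩
  -- charts at `w` and at `e w`
  set φ := chartAt (EuclideanHalfSpace (n + 1)) w with hφ
  set ψ := chartAt (EuclideanSpace ℝ (Fin (n + 1))) (e w) with hψ
  have hwφ : w ∈ φ.source := mem_chart_source _ w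
  have hewψ : e w ∈ ψ.source := mem_chart_source _ (e w)
  -- the inverse of `e` on its range is continuous
  set einv : X → W := Function.invFun e with heinv
  have hinv : ∀ x, einv (e x) = x := Function.leftInverse_invFun he.injective
  have heinvc : ContinuousOn einv (range e) := by
    rw [continuousOn_iff_continuous_restrict]
    have : (range e).restrict einv = he.toHomeomorph.symm := by
      ext ⟨y, x, rfl⟩
      change einv (e x) = he.toHomeomorph.symm ⟨e x, _⟩
      rw [hinv]
      exact (he.toHomeomorph.symm_apply_apply x).symm.trans rfl
    rw [this]
    exact he.toHomeomorph.symm.continuous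
  -- `e '' φ.source` is open in `range e`: `= range e ∩ O₂`
  obtain ⟨O₂, hO₂, hO₂e⟩ : ∃ O₂ : Set X, IsOpen O₂ ∧ e ⁻¹' O₂ = φ.source :=
    he.isInducing.isOpen_iff.1 φ.open_source
  -- an open `O ⊆ range e` around `e w`
  obtain ⟨O, hOr, hO, hewO⟩ := mem_nhds_iff.1 h
  -- the open set in the model space of `X` and the composite map
  set D : Set (EuclideanSpace ℝ (Fin (n + 1))) := ψ.target ∩ ψ.symm ⁻¹' (O ∩ O₂) with hD
  have hDo : IsOpen D := ψ.isOpen_inter_preimage_symm (hO.inter hO₂)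
  set g : EuclideanSpace ℝ (Fin (n + 1)) → EuclideanSpace ℝ (Fin (n + 1)) :=
    fun u => (φ (einv (ψ.symm u))).val with hg
  -- on `D`: `ψ.symm u ∈ O ∩ O₂ ⊆ range e`, `einv (ψ.symm u) ∈ φ.source`
  have hD1 : ∀ u ∈ D, ψ.symm u ∈ range e := fun u hu => hOr hu.2.1
  have hD2 : ∀ u ∈ D, einv (ψ.symm u) ∈ φ.source := by
    intro u hu
    obtain ⟨x, hx⟩ := hD1 u hu
    rw [← hx, hinv, ← hO₂e, mem_preimage, hx]
    exact hu.2.2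
  have hgc : ContinuousOn g D := by
    refine continuous_subtype_val.comp_continuousOn ?_
    refine φ.continuousOn.comp ?_ hD2
    exact heinvc.comp (ψ.continuousOn_symm.mono inter_subset_left) hD1
  have hginj : InjOn g D := by
    intro u hu v hv huv
    have h1 : φ (einv (ψ.symm u)) = φ (einv (ψ.symm v)) := Subtype.ext huv
    have h2 : einv (ψ.symm u) = einv (ψ.symm v) := φ.injOn (hD2 u hu) (hD2 v hv) h1
    have h3 : ψ.symm u = ψ.symm v := by
      obtain ⟨x, hx⟩ := hD1 u hu
      obtain ⟨y, hy⟩ := hD1 v hv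
      rw [← hx, ← hy, hinv, hinv] at h2
      rw [← hx, ← hy, h2]
    exact ψ.symm.injOn hu.1 hv.1 h3
  -- invariance of domain: `g '' D` is open, and it lies in the closed half-space
  have hopen : IsOpen (g '' D) :=
    Euclidean.Brouwer.isOpen_image_of_injOn rfl hDo hgc hginj
  have hsub : g '' D ⊆ {y | 0 ≤ y 0} := by
    rintro _ ⟨u, -, rfl⟩
    exact (φ (einv (ψ.symm u))).2
  have hint : g '' D ⊆ {y | 0 < y 0} := by
    rw [← interior_halfSpace 2 (0 : ℝ) (0 : Fin (n + 1))]
    exact interior_maximal hsub hopen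
  -- the chart value of `w` is `g (ψ (e w))`, with `ψ (e w) ∈ D`
  have hu₀ : ψ (e w) ∈ D := by
    refine ⟨ψ.map_source hewψ, ?_⟩
    rw [mem_preimage, ψ.left_inv hewψ]
    refine ⟨hewO, ?_⟩
    have : w ∈ e ⁻¹' O₂ := by rw [hO₂e]; exact hwφ
    exact this
  have hgw : g (ψ (e w)) = (φ w).val := by
    simp only [hg, ψ.left_inv hewψ, hinv]
  have hpos : 0 < (φ w).val 0 := by
    have := hint ⟨_, hu₀, hgw⟩
    exact this
  -- conclude
  change extChartAt (𝓡∂ (n + 1)) w w ∈ interior (range (𝓡∂ (n + 1)))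
  rw [interior_range_modelWithCornersEuclideanHalfSpace]
  exact hpos

/-- **Boundary points are not interior to the image**: for a topological embedding of an
`(n+1)`-manifold with boundary into an `(n+1)`-manifold without boundary, `range e` is not a
neighbourhood of the image of a boundary point. [cite: HatcherAT2002, Thm. 2B.3 and the remark following it] -/
theorem not_mem_nhds_of_isBoundaryPoint {e : W → X} (he : IsEmbedding e) {w : W}
    (hw : (𝓡∂ (n + 1)).IsBoundaryPoint w) : range e ∉ 𝓝 (e w) := fun h =>
  (ModelWithCorners.disjoint_interior_boundary (I := 𝓡∂ (n + 1)) (M := W)).le_bot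
    ⟨isInteriorPoint_of_range_mem_nhds he h, hw⟩

end Literature.Topology.FourManifolds
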